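import Summits.ValiantsHypothesis.ValiantsHypothesis.Theorems.GeneratorObstructionsPerGenDegreeSuperQPCollapsedPermanent

/-!
# Route GeneratorObstructions — K1 `PerGenDegreeSuperQP` (stmt-ValiantsHypothesis-11654),
# line `per-side-atoms`: the rays `j = m·r` (`r ∣ m`) of `S(per_m)` are HIT and carry atoms
# (column-collapsed permanents as polystable degenerations of `per_m`)

Eleventh support file of the line; consequences of `…CollapsedPermanent` (the column-collapsed
permanent `P_{r,t} = per_m(x_{ik} ↦ y_{i,b(k)})`, `m = r t`, is polystable) and `…RayCriterion`
(ray `j` of `S(f)` is hit iff some `j`-variable degeneration of `f` is `SL_j`-semistable):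

* `rename_collapsedPer_mem_orbitClosure_per` — placing `y_{i,s}` at the matrix position `(i,s)`
  exhibits `P_{r,t}` as the renaming `x_{ik} ↦ x_{i,b(k)}` of `per_m`, a point of
  `End·per_m ⊆ Δ(per_m)`: the collapsed permanent is an `m r`-variable DEGENERATION of `per_m`.
* `per_ray_hit_collapsed` — **the ray `j = m·r` of `S(per_m)` is hit** (`m = r t`, `r, t ≥ 1`):
  `(k^{mr})^* ∈ S(per_m)` for some `k ≥ 1`.
* `per_exists_ray_atom_collapsed` — hence (extremal-ray principle, `…RectangularRays`) the
  occurrence monoid of the permanent has an ATOM `(k₀^{mr})^*` on each such ray, of degree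
  `k₀ r ≤ e(P_{r,t})`, BI 2017's minimal degree of the collapsed permanent (the least degree of
  an `SL_{mr}`-invariant of `m`-ics not vanishing at `P_{r,t}`; unknown for `1 < r < m`).

These rays have lengths `m < m r < m²` for `1 < r < m` — the first unconditional information
about `S(per_m)` in the range where a LATE start would prove the registered `stub_atomLate`
(`…RayCriterion.stub_atomLate_of_nullcone_inseparable`) and where the literature is silent
(Bürgisser–Hüttenhain–Ikenmeyer 2017 reach `ℓ ≤ n` for `Det_n` via the Chow variety only).
What remains for the stub on these rays is a super-quasi-polynomial LOWER bound, for infinitely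
many `m` and some `r ∣ m`, on the least degree of an `SL_{mr}`-invariant detecting some
`m r`-variable degeneration of `per_m` — e.g. `e(P_{r,t})` itself if the collapsed permanent
turns out to be the generic point of that ray.

Honest framing: unconditional structure theorems; the DEGREES of these atoms are not determined;
`stub_atomLate` (`c ≥ 2`), K1 and `GenFlipThesis` remain OPEN; nothing here bears on VP versus
VNP. References: [BurgisserIkenmeyer2017] Prop. 2.8, Cor. 2.9, Def. 3.3;
[BurgisserHuttenhainIkenmeyer2017] Thm. 1; [MulmuleySohoni2001] §4.
-/

set_option linter.dupNamespace false

noncomputable section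

namespace Summit.ValiantsHypothesis.ValiantsHypothesis.Theorems.GeneratorObstructions.PerGenDegreeSuperQP

open MvPolynomial
open Literature.NumberTheory.DiophantineGeometry Literature.Computability.AlgebraicComplexity
  Literature.Computability.Complexity

/-! ### The collapsed permanent is a degeneration of `per_m`; the rays `j = m·r` are hit -/

section Rays

variable {r t : ℕ}

/-- **The collapsed permanent is a degeneration of the permanent.** Placing the variable `y_{i,s}`
at the matrix position `(i, s)` (`s < r ≤ m`, an injective placement), the collapsed permanent
becomes the renaming `x_{ik} ↦ x_{i, b(k)}` of `per_m` — a point of the endomorphism orbit, hence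
of `Δ(per_m)`. [cite: MulmuleySohoni2001, §4] -/
theorem rename_collapsedPer_mem_orbitClosure_per (hrm : r ≤ r * t) :
    MvPolynomial.rename
        (fun y : Fin (r * t * r) =>
          (toLex ((finProdFinEquiv.symm y).1, Fin.castLE hrm (finProdFinEquiv.symm y).2) : MatIdx (r * t)))
        (MvPolynomial.rename
          (fun ik : Fin (r * t) × Fin (r * t) =>
            (finProdFinEquiv (ik.1, (finProdFinEquiv.symm ik.2).1) : Fin (r * t * r)))
          (perPoly (Fin (r * t)) ℂ)) ∈
      orbitClosure (MvPolynomial.rename (toLex : Fin (r * t) × Fin (r * t) → MatIdx (r * t))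
        (perPoly (Fin (r * t)) ℂ)) := by
  haveI : Infinite ℂ := CharZero.infinite ℂ
  have hmem := rename_mem_orbitClosure_of_selfMap
    (fun x : MatIdx (r * t) =>
      (toLex ((ofLex x).1, Fin.castLE hrm (finProdFinEquiv.symm (ofLex x).2).1) : MatIdx (r * t)))
    (MvPolynomial.rename (toLex : Fin (r * t) × Fin (r * t) → MatIdx (r * t)) (perPoly (Fin (r * t)) ℂ))
  rw [rename_rename] at hmem
  rw [rename_rename]
  have hfun : ((fun y : Fin (r * t * r) =>
        (toLex ((finProdFinEquiv.symm y).1, Fin.castLE hrm (finProdFinEquiv.symm y).2) : MatIdx (r * t))) ∘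
      (fun ik : Fin (r * t) × Fin (r * t) =>
        (finProdFinEquiv (ik.1, (finProdFinEquiv.symm ik.2).1) : Fin (r * t * r)))) =
      ((fun x : MatIdx (r * t) =>
        (toLex ((ofLex x).1, Fin.castLE hrm (finProdFinEquiv.symm (ofLex x).2).1) : MatIdx (r * t))) ∘
        (toLex : Fin (r * t) × Fin (r * t) → MatIdx (r * t))) := by
    funext ik
    simp only [Function.comp_apply, Equiv.symm_apply_apply, ofLex_toLex]
  rw [hfun]
  exact hmem

/-- **The rays `j = m·r`, `r ∣ m`, of `S(per_m)` are hit.** For `m = r t` (`r, t ≥ 1`) the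
rectangular weight `(k^{m r})^*` occurs in `ℂ[Δ_m[per_m]]` for some `k ≥ 1`: the collapsed
permanent on `m r` of the matrix variables is a polystable (`isPolystable_collapsedPer`), hence
`SL_{mr}`-semistable, degeneration of `per_m`, and the ray criterion applies. These rays have
length `m r` strictly between `m` and `m²` for `1 < r < m` — the range on which nothing about
`S(per_m)` was known. [cite: BurgisserIkenmeyer2017, Prop. 2.8 and Def. 3.3] -/
theorem per_ray_hit_collapsed (hr : 0 < r) (ht : 0 < t) :
    ∃ k : ℕ, 0 < k ∧
      highestWeightSpace (orbitCoordRep (MvPolynomial.rename toLex (perPoly (Fin (r * t)) ℂ)) (r * t))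
        (partitionWeightLex (r * t) (Nat.Partition.rectangle (r * t * r) k)) ≠ ⊥ := by
  have hrm : r ≤ r * t := Nat.le_mul_of_pos_right r ht
  have hm : r * t ≠ 0 := (Nat.mul_pos hr ht).ne'
  have hj : 0 < r * t * r := Nat.mul_pos (Nat.mul_pos hr ht) hr
  have hκ : Function.Injective (fun y : Fin (r * t * r) =>
      (toLex ((finProdFinEquiv.symm y).1, Fin.castLE hrm (finProdFinEquiv.symm y).2) : MatIdx (r * t))) := by
    intro y y' h
    have h' := congrArg (fun x : MatIdx (r * t) => ofLex x) h
    simp only [ofLex_toLex, Prod.mk.injEq] at h'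
    apply finProdFinEquiv.symm.injective
    exact Prod.ext h'.1 (Fin.castLE_injective hrm h'.2)
  obtain ⟨k, hk, hocc⟩ := exists_hasHighestWeight_rectangle_of_isSLSemistable_projection
    (matIdxEquiv (r * t)) hm (perFormLex_isHomogeneous (r * t)) hj _ hκ
    collapsedPer_isHomogeneous (rename_collapsedPer_mem_orbitClosure_per hrm)
    ((isPolystable_collapsedPer hr ht).isSLSemistable collapsedPer_ne_zero)
  exact ⟨k, hk, hocc⟩

/-- **Each ray `j = m·r` carries an atom.** For `m = r t` (`r, t ≥ 1`) the occurrence monoid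
`S(per_m)` has an ATOM of the shape `(k₀^{m r})^*`, `k₀ ≥ 1` — the first weight on the ray
(`exists_least_rectangle_atom`); its degree `k₀ r` is at most BI 2017's minimal degree `e` of the
collapsed permanent, and a super-quasi-polynomial lower bound for it at infinitely many `m` would
prove `stub_atomLate` (`…RayCriterion.stub_atomLate_of_nullcone_inseparable`).
[cite: BurgisserIkenmeyer2017, Prop. 2.8 and Def. 3.3] -/
theorem per_exists_ray_atom_collapsed (hr : 0 < r) (ht : 0 < t) :
    ∃ k₀ : ℕ, 0 < k₀ ∧
      highestWeightSpace (orbitCoordRep (MvPolynomial.rename toLex (perPoly (Fin (r * t)) ℂ)) (r * t))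
        (partitionWeightLex (r * t) (Nat.Partition.rectangle (r * t * r) k₀)) ≠ ⊥ ∧
      (∀ k : ℕ, 0 < k → k < k₀ →
        highestWeightSpace (orbitCoordRep (MvPolynomial.rename toLex (perPoly (Fin (r * t)) ℂ)) (r * t))
          (partitionWeightLex (r * t) (Nat.Partition.rectangle (r * t * r) k)) = ⊥) ∧
      (∀ χ₁ χ₂ : Weight (MatIdx (r * t)),
        χ₁ + χ₂ = partitionWeightLex (r * t) (Nat.Partition.rectangle (r * t * r) k₀) →
        χ₁ ≠ 0 → χ₂ ≠ 0 →
        highestWeightSpace (orbitCoordRep (MvPolynomial.rename toLex (perPoly (Fin (r * t)) ℂ)) (r * t)) χ₁ = ⊥ ∨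
          highestWeightSpace (orbitCoordRep (MvPolynomial.rename toLex (perPoly (Fin (r * t)) ℂ)) (r * t)) χ₂ = ⊥) :=
  exists_least_rectangle_atom _ _ (Nat.mul_pos (Nat.mul_pos hr ht) hr)
    (Nat.mul_le_mul_left (r * t) (Nat.le_mul_of_pos_right r ht))
    (per_ray_hit_collapsed hr ht)

end Rays

end Summit.ValiantsHypothesis.ValiantsHypothesis.Theorems.GeneratorObstructions.PerGenDegreeSuperQP

end
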